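import Mathlib
import Summits.NavierStokesRegularity.NavierStokesRegularity.Theorems.OrthantWakeOrthantInvariance
import Summits.NavierStokesRegularity.NavierStokesRegularity.Theorems.OrthantWakeOrthantHopWakeFlux
import HarnessLib

/-!
# `OrthantWake.OrthantHopWake` (stmt-NavierStokesRegularity-24639) — negative lemma modulo the
# existence of THIN-RESIDUE STATES (parked dead-end pockets) at arbitrarily deep shells

The crux `OrthantHopWake` (K1) asks, for every spread `R ≥ 1`, for constants `η, κ₁, ε̄` chosen
BEFORE `ε₀ ≤ ε̄`, the viscosity `ν > 0`, the orthant table `α ∈ E₂(R)`, the datum and the window,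
such that every regular non-negative `ν`-viscous solution obeys the per-hop ratchet
`T_{n+1}(t) ≤ (1+ε₀)^{-(1+η)} · T_n(u)` for SOME earlier time `u ≤ t`, at every shell `n ≥ κ₁/ε₀`
(`T_n(u) = Σ_{k ≥ n} Σ_i ½ X_{i,k}(u)²`).

This file removes the "some earlier time" from any refutation. For an orthant (Kamke) cancelling
table the energy can cross a bond `n-1 → n` only FORWARD (`Π_{n-1} ≥ 0`,
`orthantHop_botSum_nonneg`) and is otherwise only dissipated, so the energy of the bottom block of
shells `< n` is non-increasing in time (`orthantHop_bottomEnergy_antitone`). Together with the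
energy inequality (`orthantBreak_energy_le`) this bounds the WHOLE PAST of a tail by its present
value plus the energy dissipated so far,
  `T_n(u) ≤ T_n(t) + (E₀ − E(t))   (0 ≤ u ≤ t)`      (`orthantHop_pastTail_le`),
`E(t) = Σ_{k ≥ 0} Σ_i ½X_{i,k}(t)²`, `E₀ = Σ_i ½ (X₀)_i²`. Consequently ONE state of ONE solution
with
  `T_{n+1}(t) > 0` and `e_n(t) + (E₀ − E(t)) ≤ ε₀ · T_{n+1}(t)`   ("thin-residue state")
at a shell `n ≥ κ₁/ε₀` violates the hop inequality at `(n, t)` against EVERY `u ≤ t` and for EVERY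
`η > 0` (`orthantHop_no_hop_of_thinResidueState`: the past of `T_n` is `≤ (1+ε₀) T_{n+1}(t)` and
`(1+ε₀)^{-(1+η)} (1+ε₀) < 1`). Conversely K1 forces the single-time RESIDUE-OR-BURN law
`ε₀ T_{n+1}(t) < e_n(t) + (E₀ − E(t))` at every deep shell with a non-empty tail
(`orthantHopWake_residueOrBurn`).

`ThinResidueStates` (a `Prop`, NOTHING asserted) is the construction the refutation is modulo:
inside one class E₂(R), at arbitrarily small `ε₀`, thin-residue states at arbitrarily deep shells.
**`orthantHopWake_false_of_thinResidueStates : ThinResidueStates → ¬ OrthantHopWake`.**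

WHY ONE EXPECTS `ThinResidueStates` (evidence, not proof; prover census CENSUS-24639 v3.3 on the
item, instrument `lattice_24639.c`): the orthant table `T₁₀ ∈ E₂(10)` (chain `x_{0,k}² → x_{0,k+1}`,
in-shell pair `0 → 1` (0.2), side re-entry `x_{1,k}² → x_{0,k+1}`, and a DEAD-END feed
`x_{1,k}² → x_{2,k+1}` (0.2) into a mode with no exit) parks a fraction `≈ (0.2–0.5)·ε₀` of the
passing energy permanently in each shell's dead-end pocket; as `ν ↓ 0` nothing reaches the
dissipation range (geometric absorption), the transit modes drain, and at late times
`e_n(t) ≈ p_n ≈ (0.2–0.5) ε₀ · T_{n+1}(t)` while `E₀ − E(t) → 0`: measured per-hop exponents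
`W = 0.20–0.47 < 1` on the whole computed inertial band for `ε₀ = 1/2 … 1/64`, decreasing as `ν ↓`.
The limit `ε₀ → 0` inside a FIXED E₂(R) is extrapolation (exposure-time heuristic: pocket share per
shell `∝` transit time per shell `∝ ε₀`); a rigorous construction needs the late-time asymptotics of
the parking front at arbitrary depth — not available in the tree, hence a hypothesis here.

HONEST FRAMING: MODEL lattice ODEs only (Tao 2016 §4 vocabulary; rung TL-M2Break); nothing here is
a statement about the Navier–Stokes equations; the theorems are conditional refutations and
elementary energy bookkeeping — they settle nothing by themselves and no summit is proved.
References for the vocabulary: [cite: Tao2016AveragedNS, §4 (4.2)–(4.3), (4.8), proof of (4.13)];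
positivity / forward flux of Katz–Pavlović-type couplings: [cite: BarbatoMorandinRomito2011, §2].
-/

noncomputable section

-- the sub-problem namespace `NavierStokesRegularity.NavierStokesRegularity` is the tree's layout (D-0017)
set_option linter.dupNamespace false

namespace Summit.NavierStokesRegularity.NavierStokesRegularity.Theorems

open Set Filter MeasureTheory
open scoped Topology
open Literature.Analysis.FluidPDE.TaoCascade

/-! ## §1 Bottom-block energies of an orthant cascade do not increase -/

/-- **Bottom blocks only lose energy.** For a cancelling table with the Kamke (orthant) property
and a solution of the `ν`-viscous lattice on `[0,s]` vanishing below shell `0` and non-negative on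
shells `≥ 1`, the energy of the shells `0, …, n-1`, `B_n(w) = Σ_{k<n} Σ_i ½X_{i,k}(w)²`, is
non-increasing on `[0,s]`: its derivative is `−Π_{n-1} − (dissipation) ≤ 0`, the bond flux
`Π_{n-1} = botSum ε₀ α X (n-1)` being `≥ 0` on the cone. [this file] -/
theorem orthantHop_bottomEnergy_antitone {ε₀ ν s : ℝ} (hε : 0 < ε₀) (hν : 0 < ν)
    {α : Fin 4 → Fin 4 → Fin 4 → ℤ × ℤ × ℤ → ℝ} (hc : IsCancellingCoeff α)
    (hK : ∀ (Y : Fin 4 → ℤ → ℝ → ℝ) (τ : ℝ), (∀ (j : Fin 4) (k : ℤ), 1 ≤ k → 0 ≤ Y j k τ) →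
      ∀ δ : ℝ, 0 < δ → ∀ (i : Fin 4) (n : ℤ), 1 ≤ n → Y i n τ = 0 → 0 ≤ quadTerm δ α Y i n τ)
    {X : Fin 4 → ℤ → ℝ → ℝ}
    (hlow : ∀ (i : Fin 4) (k : ℤ), k < 0 → ∀ t : ℝ, X i k t = 0)
    (hder : ∀ (i : Fin 4) (k : ℤ), ∀ t ∈ Icc (0 : ℝ) s, HasDerivWithinAt (X i k)
      (quadTerm ε₀ α X i k t - ν * (1 + ε₀) ^ ((2 : ℝ) * k) * X i k t) (Icc (0 : ℝ) s) t)
    (hpos : ∀ t ∈ Icc (0 : ℝ) s, ∀ (i : Fin 4) (k : ℤ), 1 ≤ k → 0 ≤ X i k t)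
    (n : ℕ) {u t : ℝ} (hu : 0 ≤ u) (hut : u ≤ t) (hts : t ≤ s) :
    ∑ k ∈ Finset.range n, ∑ i : Fin 4, (1 / 2 : ℝ) * X i (k : ℤ) t ^ 2 ≤
      ∑ k ∈ Finset.range n, ∑ i : Fin 4, (1 / 2 : ℝ) * X i (k : ℤ) u ^ 2 := by
  have h0 : (0 : ℝ) < 1 + ε₀ := by linarith
  -- the block energy and its derivative
  set B : ℝ → ℝ := fun w =>
    ∑ k ∈ Finset.range n, ∑ i : Fin 4, (1 / 2 : ℝ) * X i (k : ℤ) w ^ 2 with hB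
  set D : ℝ → ℝ := fun w => ∑ k ∈ Finset.range n, ∑ i : Fin 4,
    X i (k : ℤ) w * (quadTerm ε₀ α X i k w - ν * (1 + ε₀) ^ ((2 : ℝ) * (k : ℤ)) * X i k w)
    with hD
  have hderB : ∀ w ∈ Icc (0 : ℝ) s, HasDerivWithinAt B (D w) (Icc 0 s) w := by
    intro w hw
    simp only [hB, hD]
    refine HasDerivWithinAt.fun_sum fun k _ => HasDerivWithinAt.fun_sum fun i _ => ?_
    have h := ((hder i k w hw).pow 2).const_mul (1 / 2 : ℝ)
    refine h.congr_deriv ?_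
    rw [show (2 : ℕ) - 1 = 1 from rfl, pow_one]
    push_cast
    ring
  -- the derivative is `−Π_{n-1} − dissipation ≤ 0`
  have hDle : ∀ w ∈ Icc (0 : ℝ) s, D w ≤ 0 := by
    intro w hw
    have hstep1 : D w ≤ ∑ k ∈ Finset.range n, ∑ i : Fin 4,
        quadTerm ε₀ α X i ((0 : ℤ) + k) w * X i ((0 : ℤ) + k) w := by
      simp only [hD, zero_add]
      refine Finset.sum_le_sum fun k _ => Finset.sum_le_sum fun i _ => ?_
      have hν' : 0 ≤ ν * (1 + ε₀) ^ ((2 : ℝ) * (k : ℤ)) * X i k w ^ 2 :=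
        mul_nonneg (mul_nonneg hν.le (Real.rpow_nonneg h0.le _)) (sq_nonneg _)
      nlinarith [hν']
    rw [sum_range_sum_quadTerm_mul ε₀ hc X 0 n w] at hstep1
    have hX1 : ∀ (i : Fin 4) (w : ℝ), X i (-1) w = 0 := fun i w => hlow i (-1) (by norm_num) w
    have htop0 : topSum ε₀ α X (0 - 1) w = 0 := by
      simp [topSum, hX1]
    rw [htop0, sub_zero] at hstep1
    rcases Nat.eq_zero_or_pos n with hn | hn
    · -- empty block
      subst hn
      have hidx : (0 : ℤ) + ((0 : ℕ) : ℤ) - 1 = 0 - 1 := by norm_num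
      rw [hidx, htop0] at hstep1
      exact hstep1
    · -- the top scale of the block is `n - 1 ≥ 0`: `topSum (n-1) = -botSum (n-1) ≤ 0`
      obtain ⟨m, rfl⟩ := Nat.exists_eq_add_of_le hn
      have hidx : (0 : ℤ) + ((1 + m : ℕ) : ℤ) - 1 = (m : ℤ) := by push_cast; ring
      rw [hidx] at hstep1
      have hbot : 0 ≤ botSum ε₀ α X (m : ℤ) w :=
        orthantHop_botSum_nonneg h0.le hK (by positivity) (hpos w hw)
      have heq := botSum_eq_neg_topSum ε₀ hc X (m : ℤ) w
      linarith
  -- integrate on `[u, t] ⊆ [0, s]`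
  have hcont : ContinuousOn B (Icc 0 s) := fun w hw => (hderB w hw).continuousWithinAt
  have hdiff : DifferentiableOn ℝ B (interior (Icc 0 s)) := by
    intro w hw
    rw [interior_Icc] at hw
    exact ((hderB w ⟨hw.1.le, hw.2.le⟩).hasDerivAt
      (Icc_mem_nhds hw.1 hw.2)).differentiableAt.differentiableWithinAt
  have hle : ∀ w ∈ interior (Icc (0 : ℝ) s), deriv B w ≤ 0 := by
    intro w hw
    rw [interior_Icc] at hw
    rw [((hderB w ⟨hw.1.le, hw.2.le⟩).hasDerivAt (Icc_mem_nhds hw.1 hw.2)).deriv]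
    exact hDle w ⟨hw.1.le, hw.2.le⟩
  have h := (convex_Icc (0 : ℝ) s).image_sub_le_mul_sub_of_deriv_le hcont hdiff hle u
    ⟨hu, hut.trans hts⟩ t ⟨hu.trans hut, hts⟩ hut
  have hBt : B t ≤ B u := by linarith
  simpa only [hB] using hBt

/-! ## §2 The whole past of a tail is controlled by its present value plus the dissipated energy -/

/-- **Past tails vs. present tail.** For a cancelling orthant table and a regular solution of the
`ν`-viscous lattice on `[0,s]` from a one-shell datum `X₀` at shell `0` ((4.5) weight bound,
non-negative on shells `≥ 1`): for `0 ≤ u ≤ t ≤ s` and every shell `n`,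
`T_n(u) ≤ T_n(t) + (E₀ − E(t))`, where `T_n(w) = Σ_j Σ_i ½X_{i,n+j}(w)²`,
`E(w) = Σ_j Σ_i ½X_{i,j}(w)²` and `E₀ = Σ_i ½(X₀)_i²`. Proof: `T_n = E − B_n`, `E(u) ≤ E₀`
(`orthantBreak_energy_le`) and `B_n(t) ≤ B_n(u)` (`orthantHop_bottomEnergy_antitone`).
[this file] -/
theorem orthantHop_pastTail_le {ε₀ ν s M : ℝ} (hε : 0 < ε₀) (hν : 0 < ν)
    {α : Fin 4 → Fin 4 → Fin 4 → ℤ × ℤ × ℤ → ℝ} (hc : IsCancellingCoeff α)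
    (hK : ∀ (Y : Fin 4 → ℤ → ℝ → ℝ) (τ : ℝ), (∀ (j : Fin 4) (k : ℤ), 1 ≤ k → 0 ≤ Y j k τ) →
      ∀ δ : ℝ, 0 < δ → ∀ (i : Fin 4) (n : ℤ), 1 ≤ n → Y i n τ = 0 → 0 ≤ quadTerm δ α Y i n τ)
    {X₀ : Fin 4 → ℝ} {X : Fin 4 → ℤ → ℝ → ℝ}
    (hinit : ∀ (i : Fin 4) (k : ℤ), X i k 0 = if k = 0 then X₀ i else 0)
    (hlow : ∀ (i : Fin 4) (k : ℤ), k < 0 → ∀ t : ℝ, X i k t = 0)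
    (hM : ∀ (t : ℝ) (i : Fin 4) (k : ℤ), (1 + (1 + ε₀) ^ ((10 : ℝ) * k)) * |X i k t| ≤ M)
    (hder : ∀ (i : Fin 4) (k : ℤ), ∀ t ∈ Icc (0 : ℝ) s, HasDerivWithinAt (X i k)
      (quadTerm ε₀ α X i k t - ν * (1 + ε₀) ^ ((2 : ℝ) * k) * X i k t) (Icc (0 : ℝ) s) t)
    (hpos : ∀ t ∈ Icc (0 : ℝ) s, ∀ (i : Fin 4) (k : ℤ), 1 ≤ k → 0 ≤ X i k t)
    (n : ℕ) {u t : ℝ} (hu : 0 ≤ u) (hut : u ≤ t) (hts : t ≤ s) :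
    (∑' j : ℕ, ∑ i : Fin 4, (1 / 2 : ℝ) * X i ((n : ℕ) + (j : ℤ)) u ^ 2) ≤
      (∑' j : ℕ, ∑ i : Fin 4, (1 / 2 : ℝ) * X i ((n : ℕ) + (j : ℤ)) t ^ 2) +
        ((∑ i : Fin 4, (1 / 2 : ℝ) * X₀ i ^ 2) -
          ∑' j : ℕ, ∑ i : Fin 4, (1 / 2 : ℝ) * X i (j : ℤ) t ^ 2) := by
  -- `E(w) = B_n(w) + T_n(w)`
  have hsplit : ∀ w : ℝ, (∑' j : ℕ, ∑ i : Fin 4, (1 / 2 : ℝ) * X i (j : ℤ) w ^ 2) =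
      (∑ k ∈ Finset.range n, ∑ i : Fin 4, (1 / 2 : ℝ) * X i (k : ℤ) w ^ 2) +
        ∑' j : ℕ, ∑ i : Fin 4, (1 / 2 : ℝ) * X i ((n : ℕ) + (j : ℤ)) w ^ 2 := by
    intro w
    have hs0 : Summable fun j : ℕ => ∑ i : Fin 4, (1 / 2 : ℝ) * X i (j : ℤ) w ^ 2 :=
      (orthantBreak_summable hε hM 0 w).congr fun j => by simp
    have h := hs0.sum_add_tsum_nat_add n
    have h2 : (∑' j : ℕ, ∑ i : Fin 4, (1 / 2 : ℝ) * X i ((j + n : ℕ) : ℤ) w ^ 2) =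
        ∑' j : ℕ, ∑ i : Fin 4, (1 / 2 : ℝ) * X i ((n : ℕ) + (j : ℤ)) w ^ 2 :=
      tsum_congr fun j => Finset.sum_congr rfl fun i _ => by
        rw [show ((j + n : ℕ) : ℤ) = ((n : ℕ) : ℤ) + (j : ℤ) by push_cast; ring]
    rw [h2] at h
    linarith
  -- energy inequality at time `u` and block monotonicity on `[u, t]`
  have hEu := orthantBreak_energy_le hε hν hc hinit hlow hM hder (t := u) ⟨hu, hut.trans hts⟩
  have hB := orthantHop_bottomEnergy_antitone hε hν hc hK hlow hder hpos n hu hut hts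
  have hu' := hsplit u
  have ht' := hsplit t
  linarith

/-! ## §3 A single thin-residue state violates the hop inequality for every margin `η > 0` -/

/-- **One thin-residue state kills the hop at `(n, t)` for every `η`.** In the setting of
`orthantHop_pastTail_le`, suppose that at some time `t ∈ [0,s]` and shell `n` the tail above `n`
is non-empty, `T_{n+1}(t) > 0`, and the shell-`n` energy plus the energy dissipated so far is at
most `ε₀ · T_{n+1}(t)`. Then for every `η > 0` there is NO `u ∈ [0,t]` with
`T_{n+1}(t) ≤ (1+ε₀)^{-(1+η)} T_n(u)` — the conclusion of `OrthantHopWake` fails at `(n,t)`: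
`T_n(u) ≤ e_n(t) + T_{n+1}(t) + (E₀ − E(t)) ≤ (1+ε₀) T_{n+1}(t)` and
`(1+ε₀)^{-(1+η)}(1+ε₀) = (1+ε₀)^{-η} < 1`. [this file] -/
theorem orthantHop_no_hop_of_thinResidueState {ε₀ ν s M η : ℝ} (hε : 0 < ε₀) (hν : 0 < ν)
    (hη : 0 < η)
    {α : Fin 4 → Fin 4 → Fin 4 → ℤ × ℤ × ℤ → ℝ} (hc : IsCancellingCoeff α)
    (hK : ∀ (Y : Fin 4 → ℤ → ℝ → ℝ) (τ : ℝ), (∀ (j : Fin 4) (k : ℤ), 1 ≤ k → 0 ≤ Y j k τ) →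
      ∀ δ : ℝ, 0 < δ → ∀ (i : Fin 4) (n : ℤ), 1 ≤ n → Y i n τ = 0 → 0 ≤ quadTerm δ α Y i n τ)
    {X₀ : Fin 4 → ℝ} {X : Fin 4 → ℤ → ℝ → ℝ}
    (hinit : ∀ (i : Fin 4) (k : ℤ), X i k 0 = if k = 0 then X₀ i else 0)
    (hlow : ∀ (i : Fin 4) (k : ℤ), k < 0 → ∀ t : ℝ, X i k t = 0)
    (hM : ∀ (t : ℝ) (i : Fin 4) (k : ℤ), (1 + (1 + ε₀) ^ ((10 : ℝ) * k)) * |X i k t| ≤ M)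
    (hder : ∀ (i : Fin 4) (k : ℤ), ∀ t ∈ Icc (0 : ℝ) s, HasDerivWithinAt (X i k)
      (quadTerm ε₀ α X i k t - ν * (1 + ε₀) ^ ((2 : ℝ) * k) * X i k t) (Icc (0 : ℝ) s) t)
    (hpos : ∀ t ∈ Icc (0 : ℝ) s, ∀ (i : Fin 4) (k : ℤ), 1 ≤ k → 0 ≤ X i k t)
    {n : ℕ} {t : ℝ} (ht : t ∈ Icc (0 : ℝ) s)
    (hT : 0 < ∑' j : ℕ, ∑ i : Fin 4, (1 / 2 : ℝ) * X i ((n + 1 : ℕ) + (j : ℤ)) t ^ 2)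
    (hthin : (∑ i : Fin 4, (1 / 2 : ℝ) * X i (n : ℤ) t ^ 2) +
        ((∑ i : Fin 4, (1 / 2 : ℝ) * X₀ i ^ 2) -
          ∑' j : ℕ, ∑ i : Fin 4, (1 / 2 : ℝ) * X i (j : ℤ) t ^ 2) ≤
      ε₀ * ∑' j : ℕ, ∑ i : Fin 4, (1 / 2 : ℝ) * X i ((n + 1 : ℕ) + (j : ℤ)) t ^ 2) :
    ¬ ∃ u ∈ Icc (0 : ℝ) t,
      (∑' j : ℕ, ∑ i : Fin 4, (1 / 2 : ℝ) * X i ((n + 1 : ℕ) + (j : ℤ)) t ^ 2) ≤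
        (1 + ε₀) ^ (-(1 + η)) *
          (∑' j : ℕ, ∑ i : Fin 4, (1 / 2 : ℝ) * X i ((n : ℕ) + (j : ℤ)) u ^ 2) := by
  rintro ⟨u, hu, hle⟩
  have h0 : (0 : ℝ) < 1 + ε₀ := by linarith
  have h1 : (1 : ℝ) < 1 + ε₀ := by linarith
  set T₁ : ℝ := ∑' j : ℕ, ∑ i : Fin 4, (1 / 2 : ℝ) * X i ((n + 1 : ℕ) + (j : ℤ)) t ^ 2 with hT₁
  -- `T_n(t) = e_n(t) + T_{n+1}(t)`
  have hsplit : (∑' j : ℕ, ∑ i : Fin 4, (1 / 2 : ℝ) * X i ((n : ℕ) + (j : ℤ)) t ^ 2) =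
      (∑ i : Fin 4, (1 / 2 : ℝ) * X i (n : ℤ) t ^ 2) + T₁ := by
    have hs := orthantBreak_summable hε hM n t
    have h := hs.sum_add_tsum_nat_add 1
    rw [Finset.sum_range_one] at h
    have h2 : (∑' j : ℕ, ∑ i : Fin 4, (1 / 2 : ℝ) * X i ((n : ℤ) + ((j + 1 : ℕ) : ℤ)) t ^ 2) = T₁ :=
      tsum_congr fun j => Finset.sum_congr rfl fun i _ => by
        rw [show ((n : ℤ) + ((j + 1 : ℕ) : ℤ)) = ((n + 1 : ℕ) : ℤ) + (j : ℤ) by push_cast; ring]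
    rw [h2] at h
    have h3 : (∑ i : Fin 4, (1 / 2 : ℝ) * X i ((n : ℤ) + ((0 : ℕ) : ℤ)) t ^ 2) =
        ∑ i : Fin 4, (1 / 2 : ℝ) * X i (n : ℤ) t ^ 2 := by
      simp
    rw [h3] at h
    linarith
  -- the past of `T_n` is below `(1+ε₀) T_{n+1}(t)`
  have hpast := orthantHop_pastTail_le hε hν hc hK hinit hlow hM hder hpos n hu.1 hu.2 ht.2
  rw [hsplit] at hpast
  have hTu : (∑' j : ℕ, ∑ i : Fin 4, (1 / 2 : ℝ) * X i ((n : ℕ) + (j : ℤ)) u ^ 2) ≤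
      (1 + ε₀) * T₁ := by linarith
  -- contradiction: `T₁ ≤ (1+ε₀)^{-(1+η)} (1+ε₀) T₁ = (1+ε₀)^{-η} T₁ < T₁`
  have hr : 0 ≤ (1 + ε₀) ^ (-(1 + η)) := Real.rpow_nonneg h0.le _
  have hpow : (1 + ε₀) ^ (-(1 + η)) * (1 + ε₀) = (1 + ε₀) ^ (-η) := by
    rw [← Real.rpow_add_one h0.ne']
    congr 1
    ring
  have hlt1 : (1 + ε₀) ^ (-η) < 1 := Real.rpow_lt_one_of_one_lt_of_neg h1 (by linarith)
  have hchain : T₁ ≤ (1 + ε₀) ^ (-η) * T₁ :=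
    calc T₁ ≤ (1 + ε₀) ^ (-(1 + η)) *
          (∑' j : ℕ, ∑ i : Fin 4, (1 / 2 : ℝ) * X i ((n : ℕ) + (j : ℤ)) u ^ 2) := hle
      _ ≤ (1 + ε₀) ^ (-(1 + η)) * ((1 + ε₀) * T₁) := mul_le_mul_of_nonneg_left hTu hr
      _ = (1 + ε₀) ^ (-η) * T₁ := by rw [← mul_assoc, hpow]
  have hlt : (1 + ε₀) ^ (-η) * T₁ < T₁ := mul_lt_of_lt_one_left hT hlt1
  linarith

/-! ## §4 The construction hypothesis and the conditional refutation -/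

/-- **`ThinResidueStates` — the construction this negative lemma is modulo.** Inside ONE table
class E₂(R): for every threshold `ε̄ ∈ (0,1]` there is a scale ratio `1+ε₀ ≤ 1+ε̄` such that for
every depth `K` some viscosity `ν > 0`, some orthant (Kamke) table `α ∈ E₂(R)`, some one-shell datum
`X₀` at shell `0`, some window `[0,s]` and some regular solution `X` of the `ν`-viscous lattice on it
(vanishing below shell `0`, Tao's (4.5) weight bound, continuous modes) reach, at some shell `n ≥ K`
and time `t ∈ [0,s]`, a THIN-RESIDUE STATE: `T_{n+1}(t) > 0` and
`e_n(t) + (E₀ − E(t)) ≤ ε₀ · T_{n+1}(t)` (the energy still on shell `n` plus everything dissipated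
so far is at most `ε₀` times the energy parked above shell `n`). Numerically realised by the
dead-end tables `T_R` of the prover census (late times, `ν ↓ 0`: the transit modes drain, the
parked pockets above `n` keep `T_{n+1}`, `E₀ − E(t) → 0`); extrapolated, not computed, as
`ε₀ → 0`. A `Prop`; nothing is asserted — it is the hypothesis of
`orthantHopWake_false_of_thinResidueStates`, a CONSTRUCTION TARGET and not a published fact
(no citation: the vocabulary is Tao 2016 §4, (4.2)–(4.3), (4.8), Lemma 4.1 (4.5); the content is
the prover census of item 24639, unproved). -/
def ThinResidueStates : Prop :=
  ∃ R : ℝ, 1 ≤ R ∧ ∀ εbar : ℝ, 0 < εbar → εbar ≤ 1 → ∃ ε₀ : ℝ, 0 < ε₀ ∧ ε₀ ≤ εbar ∧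
    ∀ K : ℕ, ∃ ν : ℝ, 0 < ν ∧ ∃ α : Fin 4 → Fin 4 → Fin 4 → ℤ × ℤ × ℤ → ℝ, InTableClass R α ∧
      (∀ (Y : Fin 4 → ℤ → ℝ → ℝ) (τ : ℝ), (∀ (j : Fin 4) (k : ℤ), 1 ≤ k → 0 ≤ Y j k τ) →
        ∀ δ : ℝ, 0 < δ → ∀ (i : Fin 4) (n : ℤ), 1 ≤ n → Y i n τ = 0 → 0 ≤ quadTerm δ α Y i n τ) ∧
      ∃ (X₀ : Fin 4 → ℝ) (s : ℝ), 0 < s ∧ ∃ X : Fin 4 → ℤ → ℝ → ℝ,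
        (∀ (i : Fin 4) (k : ℤ), X i k 0 = if k = 0 then X₀ i else 0) ∧
        (∀ (i : Fin 4) (k : ℤ), k < 0 → ∀ t : ℝ, X i k t = 0) ∧
        (∃ M : ℝ, ∀ (t : ℝ) (i : Fin 4) (k : ℤ), (1 + (1 + ε₀) ^ ((10 : ℝ) * k)) * |X i k t| ≤ M) ∧
        (∀ (i : Fin 4) (k : ℤ), Continuous (X i k)) ∧
        (∀ (i : Fin 4) (k : ℤ), ∀ t ∈ Set.Icc (0 : ℝ) s, HasDerivWithinAt (X i k)
          (quadTerm ε₀ α X i k t - ν * (1 + ε₀) ^ ((2 : ℝ) * k) * X i k t) (Set.Icc (0 : ℝ) s) t) ∧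
        ∃ n : ℕ, K ≤ n ∧ ∃ t ∈ Set.Icc (0 : ℝ) s,
          0 < (∑' j : ℕ, ∑ i : Fin 4, (1 / 2 : ℝ) * X i ((n + 1 : ℕ) + (j : ℤ)) t ^ 2) ∧
          (∑ i : Fin 4, (1 / 2 : ℝ) * X i (n : ℤ) t ^ 2) +
              ((∑ i : Fin 4, (1 / 2 : ℝ) * X₀ i ^ 2) -
                ∑' j : ℕ, ∑ i : Fin 4, (1 / 2 : ℝ) * X i (j : ℤ) t ^ 2) ≤
            ε₀ * ∑' j : ℕ, ∑ i : Fin 4, (1 / 2 : ℝ) * X i ((n + 1 : ℕ) + (j : ℤ)) t ^ 2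

/-- **Negative lemma (conditional refutation of the crux).** `ThinResidueStates → ¬ OrthantHopWake`:
given the constants `η, κ₁, ε̄` of the crux for the spread `R` of the hypothesis, take its `ε₀ ≤ ε̄`
and a thin-residue state at depth `n ≥ ⌈κ₁/ε₀⌉`; the solution is non-negative on shells `≥ 1` by
cone invariance (`orthantInvariance_proof`, item 24642), so the crux applies at `(n,t)` and
contradicts `orthantHop_no_hop_of_thinResidueState`. MODEL lattice only; conditional; settles
nothing by itself. [this file] -/
theorem orthantHopWake_false_of_thinResidueStates (hH : ThinResidueStates) :
    ¬ Summit.NavierStokesRegularity.NavierStokesRegularity.Theses.OrthantWake.OrthantHopWake := by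
  intro hW
  obtain ⟨R, hR, hfam⟩ := hH
  obtain ⟨η, hη, κ₁, hκ₁, εbar, hεbar, hεbar1, hhop⟩ := hW R hR
  obtain ⟨ε₀, hε₀, hε₀le, hdepth⟩ := hfam εbar hεbar hεbar1
  obtain ⟨ν, hν, α, hα, hK, X₀, s, hs, X, hinit, hlow, hbd, hcont, hder, n, hn, t, ht, hT, hthin⟩ :=
    hdepth ⌈κ₁ / ε₀⌉₊
  -- cone invariance (item 24642, proved): the solution is non-negative on shells `≥ 1`
  have hpos : ∀ t ∈ Set.Icc (0 : ℝ) s, ∀ (i : Fin 4) (k : ℤ), 1 ≤ k → 0 ≤ X i k t :=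
    orthantInvariance_proof ε₀ ν hε₀ hν α hK X₀ s hs X hinit hlow hbd hcont hder
  -- the state sits beyond the transient depth
  have hκn : κ₁ ≤ ε₀ * n := by
    have h1 : κ₁ / ε₀ ≤ (n : ℝ) := (Nat.le_ceil _).trans (by exact_mod_cast hn)
    rw [div_le_iff₀ hε₀] at h1
    linarith
  obtain ⟨M, hM⟩ := hbd
  have hhopn := hhop ε₀ hε₀ hε₀le ν hν α hα hK X₀ s hs X hinit hlow ⟨M, hM⟩ hcont hder hpos n hκn t ht
  exact orthantHop_no_hop_of_thinResidueState hε₀ hν hη hα.2.1 hK hinit hlow hM hder hpos ht hT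
    hthin hhopn

/-! ## §5 The positive reading: what the crux forces at a single time -/

/-- **Residue-or-burn law forced by the crux.** If `OrthantHopWake` holds then for every `R ≥ 1`
there are `κ₁ > 0` and `ε̄ ∈ (0,1]` such that for `ε₀ ≤ ε̄`, every `ν > 0`, every orthant table
`α ∈ E₂(R)`, every one-shell datum and every regular `ν`-viscous solution on `[0,s]`: at EVERY shell
`n ≥ κ₁/ε₀` and EVERY time `t ≤ s` with a non-empty tail above `n`,
`ε₀ · T_{n+1}(t) < e_n(t) + (E₀ − E(t))` — shell `n` permanently retains, or the cascade has already
burned, more than `ε₀` times the energy above it (the contrapositive of §3; a SINGLE-TIME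
consequence of K1 that the numerics of the census test directly). MODEL lattice only. [this file] -/
theorem orthantHopWake_residueOrBurn
    (hW : Summit.NavierStokesRegularity.NavierStokesRegularity.Theses.OrthantWake.OrthantHopWake)
    (R : ℝ) (hR : 1 ≤ R) :
    ∃ κ₁ : ℝ, 0 < κ₁ ∧ ∃ εbar : ℝ, 0 < εbar ∧ εbar ≤ 1 ∧ ∀ ε₀ : ℝ, 0 < ε₀ → ε₀ ≤ εbar →
      ∀ ν : ℝ, 0 < ν → ∀ α : Fin 4 → Fin 4 → Fin 4 → ℤ × ℤ × ℤ → ℝ, InTableClass R α →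
      (∀ (Y : Fin 4 → ℤ → ℝ → ℝ) (τ : ℝ), (∀ (j : Fin 4) (k : ℤ), 1 ≤ k → 0 ≤ Y j k τ) →
        ∀ δ : ℝ, 0 < δ → ∀ (i : Fin 4) (n : ℤ), 1 ≤ n → Y i n τ = 0 → 0 ≤ quadTerm δ α Y i n τ) →
      ∀ (X₀ : Fin 4 → ℝ) (s : ℝ), 0 < s → ∀ X : Fin 4 → ℤ → ℝ → ℝ,
        (∀ (i : Fin 4) (k : ℤ), X i k 0 = if k = 0 then X₀ i else 0) →
        (∀ (i : Fin 4) (k : ℤ), k < 0 → ∀ t : ℝ, X i k t = 0) →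
        (∃ M : ℝ, ∀ (t : ℝ) (i : Fin 4) (k : ℤ), (1 + (1 + ε₀) ^ ((10 : ℝ) * k)) * |X i k t| ≤ M) →
        (∀ (i : Fin 4) (k : ℤ), Continuous (X i k)) →
        (∀ (i : Fin 4) (k : ℤ), ∀ t ∈ Set.Icc (0 : ℝ) s, HasDerivWithinAt (X i k)
          (quadTerm ε₀ α X i k t - ν * (1 + ε₀) ^ ((2 : ℝ) * k) * X i k t) (Set.Icc (0 : ℝ) s) t) →
        ∀ n : ℕ, κ₁ ≤ ε₀ * n → ∀ t ∈ Set.Icc (0 : ℝ) s,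
          0 < (∑' j : ℕ, ∑ i : Fin 4, (1 / 2 : ℝ) * X i ((n + 1 : ℕ) + (j : ℤ)) t ^ 2) →
          ε₀ * (∑' j : ℕ, ∑ i : Fin 4, (1 / 2 : ℝ) * X i ((n + 1 : ℕ) + (j : ℤ)) t ^ 2) <
            (∑ i : Fin 4, (1 / 2 : ℝ) * X i (n : ℤ) t ^ 2) +
              ((∑ i : Fin 4, (1 / 2 : ℝ) * X₀ i ^ 2) -
                ∑' j : ℕ, ∑ i : Fin 4, (1 / 2 : ℝ) * X i (j : ℤ) t ^ 2) := by
  obtain ⟨η, hη, κ₁, hκ₁, εbar, hεbar, hεbar1, hhop⟩ := hW R hR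
  refine ⟨κ₁, hκ₁, εbar, hεbar, hεbar1, ?_⟩
  intro ε₀ hε₀ hε₀le ν hν α hα hK X₀ s hs X hinit hlow hbd hcont hder n hκn t ht hT
  have hpos : ∀ t ∈ Set.Icc (0 : ℝ) s, ∀ (i : Fin 4) (k : ℤ), 1 ≤ k → 0 ≤ X i k t :=
    orthantInvariance_proof ε₀ ν hε₀ hν α hK X₀ s hs X hinit hlow hbd hcont hder
  have hhopn := hhop ε₀ hε₀ hε₀le ν hν α hα hK X₀ s hs X hinit hlow hbd hcont hder hpos n hκn t ht
  obtain ⟨M, hM⟩ := hbd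
  by_contra hge
  push Not at hge
  exact orthantHop_no_hop_of_thinResidueState hε₀ hν hη hα.2.1 hK hinit hlow hM hder hpos ht hT
    hge hhopn

end Summit.NavierStokesRegularity.NavierStokesRegularity.Theorems

end
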